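import Summits.BirchSwinnertonDyer.Rank1Residual.Additive.GordRankZeroChiBranch
import Summits.BirchSwinnertonDyer.Rank1Residual.Additive.GordDescentThree
import HarnessLib

/-!
# X4♯(G-ord) / X3♯(G-ord), defect 2, rank `0`: the branch side MEETS the field side —
# `BSD(E,p) ⇐ [B∘C]@0 ∧ (lower half of the over-K input)`, NO Tamagawa, NO Manin, NO twist data

HONEST FRAMING (cell `b2b-bsdres`, run/shared/lean/b2b/bsd-rank1-residual/, verbatim in every
file): the goal of the cell is to DELETE the COMBINATION-SHAPED residual classes of the
Birch–Swinnerton-Dyer formula for ALL analytic-rank `≤ 1` elliptic curves over `ℚ` — "full BSD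
formula for every rank `≤ 1` curve in class `C`" assembled STRICTLY from published theorems — so
that the rank-`≤ 1` remainder becomes exactly the CONSTRUCTION-SHAPED classes, which are TYPED
(missing-input `Prop`s), NOT attempted. This is not "finishing BSD". Sub-cell `additive-p2`
(CLASS-OWNERS row "X3/X4 additive — pot. good ordinary / X3♯(G-ord)"), generation 7: research
route; no claim beyond the stated classes; theorems only, no definition, no new named fact;
X3♯(G-ord)/X4♯(G-ord) stay CONSTRUCTION-SHAPED; labels / census / located gap UNCHANGED.

WHAT THIS FILE DOES (the (G)-twin of §2 of additive-p1's `AdditivePotMult/RankZeroChiBranch.lean`).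
The sub-cell has TWO typed residues for a defect-2 (G)-ordinary pair: the BRANCH side (additive-p4's
`ChiBranchLeadingTerm[Odd][BigImage]At W p` = the `χ_p`-eigenspace Eisenstein divisibility at
`T = 0`, which gives the UPPER half of `BSD(E,p)` in rank `0` — `GordRankZeroChiBranch.lean`, gen 7)
and the FIELD side (additive-p1's `MissingLowerBoundOverCAt (W.baseChange K) p` = the lower half of
the `p`-part of BSD for `E/K` over a quadratic `K` ramified at `p` — the free descent field of gen 6).
Here they are shown JOINTLY SUFFICIENT, with NO Tamagawa hypothesis, NO Manin datum and NO datum on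
a twist (gen 3's `GordDescentOneSided.lean` needed Kim 2026: Manin + `p ∤ ∏ c_ℓ`):

* `ClassX4Gord.missingLowerBoundAt_of_forall_ramified_lowerOverC` (`p ≥ 5`, `ρ̄` onto, `r_an ≤ 1`)
  and `…_three` (`p = 3`): the LOWER half over `ℚ` from the lower halves over the quadratic `K`
  with `p ∣ d_K` (Hoffstein–Luo supply → rank-0 good ordinary twist `E^{(p*d')}` of row C2
  (Burungale–Castella–Skinner Cor. 1.3.1) resp. C16 (Yan–Zhu Thm. 4.15 / Wuthrich Lemma 20) → Milne
  any-model descent `missingLowerBoundAt_iff_overC`);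
* `ClassX3Gord.missingLowerBoundAt_of_forall_ramified_lowerOverC` (any odd `p`, `r_an ≤ 1`; row C6,
  Castella–Grossi–Skinner Thm. D chain);
* **`ClassX4Gord.bsdp_rankZero_of_chiBranch_of_forall_ramified_lowerOverC`** (`p ≥ 5`) /
  **`…_three`** (`p = 3`, `ram(3)`): X4♯(G-ord) ∩ `I₀*`, `r_an = 0`, `ρ̄` onto —
  **`BSD(E,p) ⇐ [B∘C]@0 ∧ (lower half over the ramified quadratic fields)`**;
* **`ClassX3Gord.bsdp_rankZero_of_chiBranch_of_forall_ramified_lowerOverC`** (odd `p`): the same on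
  X3♯(G-ord) ∩ `I₀*` (reducible branch inputs `ChiBranchLeadingTerm[Odd]At`; `p ∤ c_p` automatic).

Located gap UNCHANGED (AUDIT-X34-GORD.md §3): both residues are readings of ONE object — the
`ω^{(p−1)/2}`-branch main-conjecture divisibility on a datum ramified at `p` (BSTW arXiv:2409.01350
Thm. 1.21(c) ANNOUNCED for the branch side; nothing in print over `K` at a ramified prime). Labels
UNCHANGED; nothing booked.

References: D. Delbourgo, Compositio Math. 113 (1998) Prop. 4; J. S. Milne, Invent. Math. 17 (1972);
J. Hoffstein, W. Luo, Math. Res. Lett. 4 (1997); A. Burungale, F. Castella, C. Skinner, IMRN 2025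
Cor. 1.3.1; F. Castella, G. Grossi, C. Skinner (2025) Thm. D; X. Yan, X. Zhu (2026) Thm. 4.15.
-/

noncomputable section

open scoped Classical MatrixGroups ModularForm NumberField

open CongruenceSubgroup WeierstrassCurve NumberField Literature.NumberTheory.EllipticCurves
  Literature.NumberTheory.EllipticCurves.ModularForms
  Literature.NumberTheory.EllipticCurves.Rank1Residual
  Literature.NumberTheory.EllipticCurves.Rank1Residual.Typed
  Literature.NumberTheory.EllipticCurves.Wuthrich2014
  IsDedekindDomain Rat.HeightOneSpectrum Summit.BirchSwinnertonDyer.Rank1Residual.AdditivePotMult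

namespace Summit.BirchSwinnertonDyer.Rank1Residual.Additive

variable (W : WeierstrassCurve ℚ) [W.IsElliptic] [W.IsGloballyMinimal] (p : ℕ) [hp : Fact p.Prime]

/-! ### §1 A good ORDINARY globally minimal model of `E^{(p*)}` at every odd `p` (defect 2) -/

/-- **The twist `E^{(p*)}` has a globally minimal model, good ORDINARY at `p`**, for every
(G)-ordinary additive pair of defect `2` at an odd prime: `p ≥ 5` by gen 4's
`exists_goodOrd_twist_pStar_of_typeGOrd`, `p = 3` by gen 7's `goodOrd_twist_three_of_typeGOrd`
(Tate's algorithm; no datum). -/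
theorem TypeGOrd.exists_goodOrd_model_twist_pStar (hp2 : p ≠ 2) (hG : TypeGOrd W p) (hadd : Addv W p)
    (he : semistabilityIndex W p = 2) :
    ∃ (W₁ : WeierstrassCurve ℚ) (_ : W₁.IsElliptic) (_ : W₁.IsGloballyMinimal),
      (∃ C : VariableChange ℚ, C • W.quadraticTwist ((-1 : ℚ) ^ (p / 2) * p) = W₁) ∧ GoodOrd W₁ p := by
  by_cases hp3 : p = 3
  · subst hp3
    haveI := W.isElliptic_quadraticTwist (pStar_ne_zero 3)
    obtain ⟨C₁, hCmin⟩ :=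
      hasGlobalMinimalModel_rat_holds (W.quadraticTwist ((-1 : ℚ) ^ ((3 : ℕ) / 2) * (3 : ℕ)))
    haveI := hCmin
    exact ⟨C₁ • W.quadraticTwist ((-1 : ℚ) ^ ((3 : ℕ) / 2) * (3 : ℕ)), inferInstance, hCmin,
      ⟨C₁, rfl⟩, goodOrd_twist_three_of_typeGOrd W hG hadd _ ⟨C₁, rfl⟩⟩
  · have hp5 : 5 ≤ p := by
      rcases Nat.lt_or_ge p 5 with h | h
      · interval_cases p <;> first | omega | exact absurd hp.out (by decide)
      · exact h
    obtain ⟨W₁, iW₁, iW₁m, C₁, hC₁, hord⟩ := exists_goodOrd_twist_pStar_of_typeGOrd W p hp5 hG he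
    exact ⟨W₁, iW₁, iW₁m, ⟨C₁, hC₁⟩, hord⟩

variable {W p}

/-! ### §2 The lower half over `ℚ` from the lower half of the over-`K` input (free descent field) -/

/-- **X4♯(G-ord) ∩ `I₀*`, `p ≥ 5`, `ρ̄_{E,p}` onto, `r_an(E) ≤ 1`: the LOWER half over `ℚ` from the
lower halves over the quadratic fields RAMIFIED at `p`.** The Hoffstein–Luo supply gives a good
ORDINARY rank-`0` twist `E^{(p*d')}` (row C2, `BSD` by Burungale–Castella–Skinner Cor. 1.3.1); over
`K = ℚ(√(p*d'))` Milne's any-model formula descends the lower half (`missingLowerBoundAt_iff_overC`).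
NO twist datum, NO Tamagawa/Manin. [cite: HoffsteinLuo1997, Theorem (§1, pp. 435–436)]
[cite: BurungaleCastellaSkinner2025, Cor. 1.3.1 (p. 4)] -/
theorem ClassX4Gord.missingLowerBoundAt_of_forall_ramified_lowerOverC
    (hGZK : rank_eq_analyticRank_of_analyticRank_le_one) (hmod : hasEntireLFunction_rat)
    (hMilneC : Milne1972.bsdQuotient_baseChange_quadratic_anyModel)
    (hBCS : BurungaleCastellaSkinner2025.cor131_padicValRat_bsd_rank_le_one)
    (hHL : HoffsteinLuo1997_exists_twist_L_one_ne_zero)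
    (hp5 : 5 ≤ p) (hX : ClassX4Gord W p) (he : semistabilityIndex W p = 2) (hsurj : Surj W p)
    (hr : W.analyticRank ≤ 1)
    (hK : ∀ (K : Type) [Field K] [NumberField K], Module.finrank ℚ K = 2 →
      (p : ℤ) ∣ NumberField.discr K → MissingLowerBoundOverCAt (W.baseChange K) p) :
    MissingLowerBoundAt W p := by
  have hp2 : p ≠ 2 := by omega
  obtain ⟨d', Wd, iWd, iWdm, hsq, hd8, hpd, ⟨C, hC⟩, hord, hr0⟩ :=
    exists_goodOrd_rankZero_twist_of_typeGOrd W p hHL hp5 hX.typeGOrd he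
  obtain ⟨K, iF, iN, h2, hdK⟩ := exists_quadraticField_discr_pStar_mul p hp2 hsq hd8 hpd
  have hdKQ : (NumberField.discr K : ℚ) = (-1 : ℚ) ^ (p / 2) * p * d' := by
    rw [hdK]; push_cast; ring
  have hpdK : (p : ℤ) ∣ NumberField.discr K := by rw [hdK]; exact ⟨(-1 : ℤ) ^ (p / 2) * d', by ring⟩
  have hWdK : ∃ C : VariableChange ℚ, C • W.quadraticTwist (NumberField.discr K : ℚ) = Wd := by
    rw [hdKQ]; exact ⟨C, hC⟩
  have hd0 : (NumberField.discr K : ℚ) ≠ 0 := by exact_mod_cast NumberField.discr_ne_zero K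
  have hrd : Wd.analyticRank ≤ 1 := by rw [hr0]; exact zero_le_one
  have hbsd : BSDp Wd p :=
    RowC2.bsdp hBCS hGZK hrd (rowC2_twist_of_classX4_of_surj W p Wd hp5 hX.classX4 hsurj hd0 hWdK hord)
  haveI : (W.baseChange K).IsElliptic := by rw [baseChange]; infer_instance
  have hV : ∃ C : VariableChange K, C • W.baseChange K = W.baseChange K := ⟨1, one_smul _ _⟩
  obtain ⟨-, hfinW⟩ := hGZK W hr
  obtain ⟨-, hfinD⟩ := hGZK Wd hrd
  obtain ⟨hshaK, hWR⟩ := hMilneC W K h2 Wd hWdK (W.baseChange K) hV hfinW hfinD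
  exact (missingLowerBoundAt_iff_overC W p K Wd (W.baseChange K) hmod h2 hWdK hV hfinW hfinD hshaK hWR
    hbsd).mpr (hK K h2 hpdK)

/-- **X4♯(G-ord) at `p = 3`, `ρ̄_{E,3}` onto, `r_an(E) ≤ 1`: the LOWER half over `ℚ` from the lower
halves over the quadratic fields RAMIFIED at `3`** (twist `E^{(−3)}` good ordinary by gen 7's Tate
algorithm; supply → row C16, Yan–Zhu Thm. 4.15 / Wuthrich Lemma 20; Milne).
[cite: HoffsteinLuo1997, Theorem (§1, pp. 435–436)] [cite: YanZhu2026, Thm. 4.15] -/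
theorem ClassX4Gord.missingLowerBoundAt_three_of_forall_ramified_lowerOverC
    (hYZ : YanZhu2026.thm415_padicValRat_bsd_rank_le_one)
    (hW20 : Wuthrich2014.lemma20_surjective_threeAdic_of_semistable)
    (hGZK : rank_eq_analyticRank_of_analyticRank_le_one) (hmod : hasEntireLFunction_rat)
    (hMilneC : Milne1972.bsdQuotient_baseChange_quadratic_anyModel)
    (hHL : HoffsteinLuo1997_exists_twist_L_one_ne_zero)
    (hX : ClassX4Gord W 3) (hsurj : Surj W 3) (hr : W.analyticRank ≤ 1)
    (hK : ∀ (K : Type) [Field K] [NumberField K], Module.finrank ℚ K = 2 →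
      (3 : ℤ) ∣ NumberField.discr K → MissingLowerBoundOverCAt (W.baseChange K) 3) :
    MissingLowerBoundAt W 3 := by
  obtain ⟨W₁, iW₁, iW₁m, hW₁, hord₁⟩ := TypeGOrd.exists_goodOrd_model_twist_pStar W 3 (by norm_num)
    hX.typeGOrd hX.addv.2 (semistabilityIndex_eq_two_of_typeG_three W hX.typeGOrd.typeG hX.addv.2)
  obtain ⟨d', Wd, iWd, iWdm, hsq, hd8, hpd, ⟨C, hC⟩, hord, hr0, -⟩ :=
    exists_goodOrd_rankZero_nonAnom_twist_of_goodOrd_model W 3 hHL (by omega) W₁ hW₁ hord₁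
  obtain ⟨K, iF, iN, h2, hdK⟩ := exists_quadraticField_discr_pStar_mul 3 (by omega) hsq hd8 hpd
  have hdKQ : (NumberField.discr K : ℚ) = (-1 : ℚ) ^ ((3 : ℕ) / 2) * (3 : ℕ) * d' := by
    rw [hdK]; push_cast; ring
  have hpdK : (3 : ℤ) ∣ NumberField.discr K := by
    rw [hdK]; exact ⟨(-1 : ℤ) ^ ((3 : ℕ) / 2) * d', by push_cast; ring⟩
  have hd0 : ((-1 : ℚ) ^ ((3 : ℕ) / 2) * (3 : ℕ) * d') ≠ 0 :=
    mul_ne_zero (pStar_ne_zero 3) (by exact_mod_cast hsq.ne_zero)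
  have hrd : Wd.analyticRank ≤ 1 := by rw [hr0]; exact zero_le_one
  have hrow : RowC16 Wd 3 :=
    ⟨rfl, hord, (irr_iff_of_model_twist hd0 ⟨C, hC⟩).mpr hX.classX4.2.2,
      Or.inl ((surj_iff_of_model_twist W 3 hd0 ⟨C, hC⟩).mpr hsurj)⟩
  have hbsd : BSDp Wd 3 := RowC16.bsdp hYZ hW20 hmod hGZK hrd hrow
  have hWdK : ∃ C : VariableChange ℚ, C • W.quadraticTwist (NumberField.discr K : ℚ) = Wd := by
    rw [hdKQ]; exact ⟨C, hC⟩
  haveI : (W.baseChange K).IsElliptic := by rw [baseChange]; infer_instance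
  have hV : ∃ C : VariableChange K, C • W.baseChange K = W.baseChange K := ⟨1, one_smul _ _⟩
  obtain ⟨-, hfinW⟩ := hGZK W hr
  obtain ⟨-, hfinD⟩ := hGZK Wd hrd
  obtain ⟨hshaK, hWR⟩ := hMilneC W K h2 Wd hWdK (W.baseChange K) hV hfinW hfinD
  exact (missingLowerBoundAt_iff_overC W 3 K Wd (W.baseChange K) hmod h2 hWdK hV hfinW hfinD hshaK hWR
    hbsd).mpr (hK K h2 hpdK)

/-- **X3♯(G-ord) ∩ `I₀*` (odd `p`), `r_an(E) ≤ 1`: the LOWER half over `ℚ` from the lower halves over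
the quadratic fields RAMIFIED at `p`** (a non-anomalous good ordinary rank-0 twist `E^{(p*d')}`, row C6
— Castella–Grossi–Skinner Thm. D chain; Milne). [cite: HoffsteinLuo1997, Theorem (§1, pp. 435–436)]
[cite: CastellaGrossiSkinner2025, Thm. D (= 'Thm. 4')] -/
theorem ClassX3Gord.missingLowerBoundAt_of_forall_ramified_lowerOverC
    (hCGS : CastellaGrossiSkinner2025.thmD_padicValRat_bsd_rank_le_one)
    (hGV : GreenbergVatsal2000.thm13_charIdeal_eq_of_gvPar) (hGr : greenberg_charValue_rankZero)
    (hmod : hasEntireLFunction_rat) (hmodP : nonempty_modularParametrizationData)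
    (hGZK : rank_eq_analyticRank_of_analyticRank_le_one)
    (hMilneC : Milne1972.bsdQuotient_baseChange_quadratic_anyModel)
    (hHL : HoffsteinLuo1997_exists_twist_L_one_ne_zero)
    (hp2 : p ≠ 2) (hX : ClassX3Gord W p) (he : semistabilityIndex W p = 2) (hr : W.analyticRank ≤ 1)
    (hK : ∀ (K : Type) [Field K] [NumberField K], Module.finrank ℚ K = 2 →
      (p : ℤ) ∣ NumberField.discr K → MissingLowerBoundOverCAt (W.baseChange K) p) :
    MissingLowerBoundAt W p := by
  obtain ⟨W₁, iW₁, iW₁m, hW₁, hord₁⟩ :=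
    TypeGOrd.exists_goodOrd_model_twist_pStar W p hp2 hX.typeGOrd hX.addv he
  obtain ⟨d', Wd, iWd, iWdm, hsq, hd8, hpd, ⟨C, hC⟩, hord, hr0, hna⟩ :=
    exists_goodOrd_rankZero_nonAnom_twist_of_goodOrd_model W p hHL hp2 W₁ hW₁ hord₁
  obtain ⟨K, iF, iN, h2, hdK⟩ := exists_quadraticField_discr_pStar_mul p hp2 hsq hd8 hpd
  have hdKQ : (NumberField.discr K : ℚ) = (-1 : ℚ) ^ (p / 2) * p * d' := by
    rw [hdK]; push_cast; ring
  have hpdK : (p : ℤ) ∣ NumberField.discr K := by rw [hdK]; exact ⟨(-1 : ℤ) ^ (p / 2) * d', by ring⟩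
  have hd0 : ((-1 : ℚ) ^ (p / 2) * p * d') ≠ 0 :=
    mul_ne_zero (pStar_ne_zero p) (by exact_mod_cast hsq.ne_zero)
  have hrd : Wd.analyticRank ≤ 1 := by rw [hr0]; exact zero_le_one
  have hp2' : 2 < p := lt_of_le_of_ne hp.out.two_le (Ne.symm hp2)
  have hbsd : BSDp Wd p := RowC6.bsdp hCGS hGV hGr hmod hmodP hGZK hrd
    (rowC6_twist_of_classX3_of_not_dvd W p Wd hp2' hX.classX3 hd0 ⟨C, hC⟩ hord hna)
  have hWdK : ∃ C : VariableChange ℚ, C • W.quadraticTwist (NumberField.discr K : ℚ) = Wd := by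
    rw [hdKQ]; exact ⟨C, hC⟩
  haveI : (W.baseChange K).IsElliptic := by rw [baseChange]; infer_instance
  have hV : ∃ C : VariableChange K, C • W.baseChange K = W.baseChange K := ⟨1, one_smul _ _⟩
  obtain ⟨-, hfinW⟩ := hGZK W hr
  obtain ⟨-, hfinD⟩ := hGZK Wd hrd
  obtain ⟨hshaK, hWR⟩ := hMilneC W K h2 Wd hWdK (W.baseChange K) hV hfinW hfinD
  exact (missingLowerBoundAt_iff_overC W p K Wd (W.baseChange K) hmod h2 hWdK hV hfinW hfinD hshaK hWR
    hbsd).mpr (hK K h2 hpdK)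

/-! ### §3 The branch side meets the field side -/

/-- **X4♯(G-ord) ∩ `I₀*`, `r_an = 0`, `p ≥ 5`, `ρ̄_{E,p}` onto: `BSD(E,p)` from the typed `χ_p`-branch
input (UPPER half, `GordRankZeroChiBranch.lean`) and the LOWER half of the over-`K` input over the
quadratic fields ramified at `p` — NO Tamagawa hypothesis, NO Manin datum, NO twist data.** The two
typed residues of the sub-cell are jointly sufficient as stated (gen 3's `GordDescentOneSided.lean`
needed Kim 2026: Manin + `p ∤ ∏ c_ℓ`). [cite: Delbourgo1998, Prop. 4 (p. 144)]
[cite: BurungaleCastellaSkinner2025, Cor. 1.3.1 (p. 4)] [cite: Milne1972ArithmeticAV, §1 Thm. 1 and Cor.] -/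
theorem ClassX4Gord.bsdp_rankZero_of_chiBranch_of_forall_ramified_lowerOverC
    (hDel : Delbourgo1998.prop4_rankZero_pow_dvd_constantCoeff)
    (hGZK : rank_eq_analyticRank_of_analyticRank_le_one) (hmod : hasEntireLFunction_rat)
    (hmodD : nonempty_modularParametrizationData)
    (hMilneC : Milne1972.bsdQuotient_baseChange_quadratic_anyModel)
    (hBCS : BurungaleCastellaSkinner2025.cor131_padicValRat_bsd_rank_le_one)
    (hHL : HoffsteinLuo1997_exists_twist_L_one_ne_zero)
    (hBCeven : ChiBranchLeadingTermBigImageAt W p) (hBCodd : ChiBranchLeadingTermOddBigImageAt W p)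
    (hp5 : 5 ≤ p) (hX : ClassX4Gord W p) (he : semistabilityIndex W p = 2) (hr : W.analyticRank = 0)
    (hsurj : Surj W p)
    (hK : ∀ (K : Type) [Field K] [NumberField K], Module.finrank ℚ K = 2 →
      (p : ℤ) ∣ NumberField.discr K → MissingLowerBoundOverCAt (W.baseChange K) p) :
    BSDp W p :=
  ClassX4Gord.bsdp_rankZero_of_chiBranch_of_lower hDel hGZK hmod hmodD hBCeven hBCodd hX he hr hsurj
    (fun h3 ↦ absurd h3 (by omega))
    (ClassX4Gord.missingLowerBoundAt_of_forall_ramified_lowerOverC hGZK hmod hMilneC hBCS hHL hp5 hX he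
      hsurj (by rw [hr]; exact zero_le_one) hK)

/-- **X4♯(G-ord) at `p = 3`, `r_an = 0`, `ρ̄_{E,3}` onto, `ram(3)`: `BSD(E,3)` from the typed
`χ_3`-branch input and the LOWER half of the over-`K` input over the quadratic fields ramified at `3`**
— NO Tamagawa, NO Manin, NO twist data (Tate's algorithm at `3`). [cite: Delbourgo1998, Prop. 4 (p. 144)]
[cite: YanZhu2026, Thm. 4.15] -/
theorem ClassX4Gord.bsdp_rankZero_three_of_chiBranch_of_forall_ramified_lowerOverC
    (hDel : Delbourgo1998.prop4_rankZero_pow_dvd_constantCoeff)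
    (hYZ : YanZhu2026.thm415_padicValRat_bsd_rank_le_one)
    (hW20 : Wuthrich2014.lemma20_surjective_threeAdic_of_semistable)
    (hGZK : rank_eq_analyticRank_of_analyticRank_le_one) (hmod : hasEntireLFunction_rat)
    (hmodD : nonempty_modularParametrizationData)
    (hMilneC : Milne1972.bsdQuotient_baseChange_quadratic_anyModel)
    (hHL : HoffsteinLuo1997_exists_twist_L_one_ne_zero)
    (hBCeven : ChiBranchLeadingTermBigImageAt W 3) (hBCodd : ChiBranchLeadingTermOddBigImageAt W 3)
    (hX : ClassX4Gord W 3) (hr : W.analyticRank = 0) (hsurj : Surj W 3) (hram : Ram W 3)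
    (hK : ∀ (K : Type) [Field K] [NumberField K], Module.finrank ℚ K = 2 →
      (3 : ℤ) ∣ NumberField.discr K → MissingLowerBoundOverCAt (W.baseChange K) 3) :
    BSDp W 3 :=
  ClassX4Gord.bsdp_rankZero_of_chiBranch_of_lower hDel hGZK hmod hmodD hBCeven hBCodd hX
    (semistabilityIndex_eq_two_of_typeG_three W hX.typeGOrd.typeG hX.addv.2) hr hsurj (fun _ ↦ hram)
    (ClassX4Gord.missingLowerBoundAt_three_of_forall_ramified_lowerOverC hYZ hW20 hGZK hmod hMilneC
      hHL hX hsurj (by rw [hr]; exact zero_le_one) hK)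

/-- **X3♯(G-ord) ∩ `I₀*` (odd `p`), `r_an = 0`: `BSD(E,p)` from the typed `χ_p`-branch input
(reducible = Wuthrich Thm. 16 side) and the LOWER half of the over-`K` input over the quadratic fields
ramified at `p`** — NO Tamagawa hypothesis (`p ∤ c_p` automatic), NO twist data.
[cite: Delbourgo1998, Prop. 4 (p. 144)] [cite: CastellaGrossiSkinner2025, Thm. D (= 'Thm. 4')] -/
theorem ClassX3Gord.bsdp_rankZero_of_chiBranch_of_forall_ramified_lowerOverC
    (hDel : Delbourgo1998.prop4_rankZero_pow_dvd_constantCoeff)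
    (hCGS : CastellaGrossiSkinner2025.thmD_padicValRat_bsd_rank_le_one)
    (hGV : GreenbergVatsal2000.thm13_charIdeal_eq_of_gvPar) (hGr : greenberg_charValue_rankZero)
    (hmod : hasEntireLFunction_rat) (hmodD : nonempty_modularParametrizationData)
    (hGZK : rank_eq_analyticRank_of_analyticRank_le_one)
    (hMilneC : Milne1972.bsdQuotient_baseChange_quadratic_anyModel)
    (hHL : HoffsteinLuo1997_exists_twist_L_one_ne_zero)
    (hBCeven : ChiBranchLeadingTermAt W p) (hBCodd : ChiBranchLeadingTermOddAt W p)
    (hp2 : p ≠ 2) (hX : ClassX3Gord W p) (he : semistabilityIndex W p = 2) (hr : W.analyticRank = 0)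
    (hK : ∀ (K : Type) [Field K] [NumberField K], Module.finrank ℚ K = 2 →
      (p : ℤ) ∣ NumberField.discr K → MissingLowerBoundOverCAt (W.baseChange K) p) :
    BSDp W p :=
  bsdp_of_missingPPartAt W p hGZK (by rw [hr]; exact zero_le_one)
    (missingPPartAt_of_lower_of_upper W p
      (ClassX3Gord.missingLowerBoundAt_of_forall_ramified_lowerOverC hCGS hGV hGr hmod hmodD hGZK hMilneC
        hHL hp2 hX he (by rw [hr]; exact zero_le_one) hK)
      (ClassX3Gord.missingUpperBoundAt_rankZero_of_chiBranch' hDel hGZK hmod hmodD hBCeven hBCodd hp2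
        hX he hr))

end Summit.BirchSwinnertonDyer.Rank1Residual.Additive

end
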